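import Mathlib
import HarnessLib
import Literature.Analysis.FluidPDE.TypeIAncientMild
import Literature.Analysis.FluidPDE.AxisymHouLiVariables
import Summits.NavierStokesRegularity.NavierStokesRegularity.Theorems.PoloidalWindowDoorPoloidalWindowRigidityWindow
import Summits.NavierStokesRegularity.NavierStokesRegularity.Theorems.PoloidalWindowDoorPoloidalWindowRigidityConstantShearMeans
import Summits.NavierStokesRegularity.NavierStokesRegularity.Theorems.PoloidalWindowDoorPoloidalWindowRigidityFirstIntegral
import Summits.NavierStokesRegularity.NavierStokesRegularity.Theorems.PoloidalWindowDoorPoloidalWindowRigidityThreadShearHessian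
import Summits.NavierStokesRegularity.NavierStokesRegularity.Theorems.PoloidalWindowDoorPoloidalWindowRigidityThreadCentreExtremum
import Summits.NavierStokesRegularity.NavierStokesRegularity.Theorems.PoloidalWindowDoorPoloidalWindowRigiditySymmetryGerms
import Summits.NavierStokesRegularity.NavierStokesRegularity.Theorems.PoloidalWindowDoorPoloidalWindowRigidityDivFormStrongMaximumPrinciple

/-!
# Route `PoloidalWindowDoor`, crux `PoloidalWindowRigidity` (K2, stmt-NavierStokesRegularity-19708) — STUB C1
# `stub_ellipticThreadEmpty` of line `thread_type` (LINE 11, ns-idea-8): NO THREAD IN A REGULAR ELLIPTIC (SUBSONIC) CORE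

Cell ns-regularity-ideate, seat ns-poloidal-K2-p2 g11 (stub-worker on K2; `--supports` the crux item; closes NO item).

The line priced C1 «provable MODULO Gilbarg–Trudinger Thm 8.19»; that named fact is now DISCHARGED in the tree
(`Literature.Analysis.PDE.divFormStrongMaximumPrinciple_holds`, ns-in-ser-b g5, p659901), so C1 lands UNCONDITIONALLY, by the instantiation
recipe of record (pub/ns-inputs 17:48:51Z):

* `frozen_shear` — the frozen law `⟪Dv(curl v), e₂⟫ = 0` (tree `…FirstIntegral.stub_firstIntegral`) with `ω₂ = 0` reads `∂_z v₀·∂₁v₂ = ∂_z v₁·∂₀v₂`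
  (vertical shear ∥ horizontal gradient of `v₂`);
* `integral_vertShear_mul_fderiv_eq_neg`, `integral_vertShear_grad_eq_zero` — for a `C²` divergence-free field `V` and a `C¹` compactly supported test `η`,
  `∫ Σᵢ ∂_z Vᵢ ∂ᵢη = −∫ (∂_z div V) η = 0` (Mathlib's integration by parts `integral_mul_fderiv_eq_neg_fderiv_mul_of_integrable`, symmetry of second
  derivatives `…ThreadShearHessian.fderiv_fderiv_apply_symm`, `Literature…fderiv_divergence_components_eq_zero`);
* `stub_ellipticThreadEmpty` — VERBATIM: on the ball `‖y‖ < δ := min δ_REG δ_ELL` put `Λ := (∂_z vₕ·∇ₕv₂)/|∇ₕv₂|²` (`:= 1` where `∇ₕv₂ = 0`; measurable),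
  `a := diag(Λ, Λ, 1)`: by the frozen law and (REG) `∂_z vₕ = Λ∇ₕv₂`, by (ELL)/(REG) `min L₀ 1 ≤ Λ`, `|Λ| ≤ max L₁ 1`; so `u := σ·v₂(−1,·)` (`σ = sign N`) is a
  `C¹` weak solution of `div(a∇u) = 0` on the ball (`a∇u = σ∂_z v`, divergence-free) attaining its maximum `|N|` at the centre (the pin
  `|v₂(−1,·)| ≤ |N|`); the strong maximum principle makes `v₂(−1,·)` constant on the ball, `…SymmetryGerms.eq_zero_of_horizontalGradient_eq_zero_on_open`
  gives `v ≡ 0`, contradicting `N ≠ 0`.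

WHAT THIS IS NOT: not a claim about Navier–Stokes regularity or K2 — the wall-free emptiness of ONE sub-cell (a thread inside a regular subsonic
core) of LINE 11; the cells C2/C3 and the THICK residues are untouched (bears_on LADDER-NS N0, rung N0-LocalTubeDoorPoloidal).
-/

noncomputable section

-- the summit and its single sub-problem share the name (CONVENTIONS §1), as in every Theorems file
set_option linter.dupNamespace false

namespace Summit.NavierStokesRegularity.NavierStokesRegularity.Theorems.PoloidalWindowDoorPoloidalWindowRigidityEllipticThreadEmpty

open MeasureTheory Set Function Filter Topology Metric Matrix
open scoped RealInnerProductSpace InnerProductSpace Matrix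
open Literature.Analysis Literature.Analysis.FluidPDE
open Summit.NavierStokesRegularity.NavierStokesRegularity.Theorems.PoloidalWindowDoorPoloidalWindowRigidityWindow
open Summit.NavierStokesRegularity.NavierStokesRegularity.Theorems.PoloidalWindowDoorPoloidalWindowRigidityConstantShearMeans
open Summit.NavierStokesRegularity.NavierStokesRegularity.Theorems.PoloidalWindowDoorPoloidalWindowRigidityFirstIntegral
open Summit.NavierStokesRegularity.NavierStokesRegularity.Theorems.PoloidalWindowDoorPoloidalWindowRigidityThreadShearHessian
open Summit.NavierStokesRegularity.NavierStokesRegularity.Theorems.PoloidalWindowDoorPoloidalWindowRigidityThreadCentreExtremum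
open Summit.NavierStokesRegularity.NavierStokesRegularity.Theorems.PoloidalWindowDoorPoloidalWindowRigiditySymmetryGerms

variable {V : EuclideanSpace ℝ (Fin 3) → EuclideanSpace ℝ (Fin 3)} {η : EuclideanSpace ℝ (Fin 3) → ℝ}

/-- **The frozen law in shear form**: if `⟨DV(y)(curl V y)⟩₂ = 0` and `(curl V y)₂ = 0` then `∂₂V₀·∂₁V₂ = ∂₂V₁·∂₀V₂` at `y`
(the vertical shear `∂_z Vₕ` is parallel to the horizontal gradient `∇ₕV₂`). -/
theorem frozen_shear {y : EuclideanSpace ℝ (Fin 3)} (hfro : fderiv ℝ V y (curl V y) 2 = 0) (h2 : curl V y 2 = 0) :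
    fderiv ℝ V y (EuclideanSpace.single 2 1) 0 * fderiv ℝ V y (EuclideanSpace.single 1 1) 2 =
      fderiv ℝ V y (EuclideanSpace.single 2 1) 1 * fderiv ℝ V y (EuclideanSpace.single 0 1) 2 := by
  have hc0 : curl V y 0 = fderiv ℝ V y (EuclideanSpace.single 1 1) 2 - fderiv ℝ V y (EuclideanSpace.single 2 1) 1 := by
    simp [curl]
  have hc1 : curl V y 1 = fderiv ℝ V y (EuclideanSpace.single 2 1) 0 - fderiv ℝ V y (EuclideanSpace.single 0 1) 2 := by
    simp [curl]
  have hdec := eq_smul_add_smul_of_apply_two h2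
  rw [hdec, map_add, map_smul, map_smul, PiLp.add_apply, PiLp.smul_apply, PiLp.smul_apply, smul_eq_mul, smul_eq_mul,
    hc0, hc1] at hfro
  linarith

/-- Integration by parts for one vertical-shear component against a `C¹` compactly supported test:
`∫ ∂₂Vᵢ · ∂ᵢη = −∫ ∂ᵢ(∂₂Vᵢ) · η`. -/
theorem integral_vertShear_mul_fderiv_eq_neg (hV : ContDiff ℝ 2 V) (hη : ContDiff ℝ 1 η) (hηc : HasCompactSupport η) (i : Fin 3) :
    ∫ y, fderiv ℝ V y (EuclideanSpace.single 2 1) i * fderiv ℝ η y (EuclideanSpace.single i 1) =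
      - ∫ y, fderiv ℝ (fun z => fderiv ℝ V z (EuclideanSpace.single 2 1) i) y (EuclideanSpace.single i 1) * η y := by
  have hF : ContDiff ℝ 1 fun z => fderiv ℝ V z (EuclideanSpace.single 2 1) i := contDiff_one_fderiv_apply hV _ i
  have hFc : Continuous fun z => fderiv ℝ V z (EuclideanSpace.single 2 1) i := hF.continuous
  have hDFc : Continuous fun y => fderiv ℝ (fun z => fderiv ℝ V z (EuclideanSpace.single 2 1) i) y (EuclideanSpace.single i 1) :=
    (hF.continuous_fderiv one_ne_zero).clm_apply continuous_const
  have hDηc : Continuous fun y => fderiv ℝ η y (EuclideanSpace.single i 1) :=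
    (hη.continuous_fderiv one_ne_zero).clm_apply continuous_const
  have hDηs : HasCompactSupport fun y => fderiv ℝ η y (EuclideanSpace.single i 1) :=
    (hηc.fderiv (𝕜 := ℝ)).comp_left (g := fun L : EuclideanSpace ℝ (Fin 3) →L[ℝ] ℝ => L (EuclideanSpace.single i 1)) rfl
  refine integral_mul_fderiv_eq_neg_fderiv_mul_of_integrable ?_ ?_ ?_ (fun x _ => (hF.differentiable one_ne_zero) x)
    (fun x _ => (hη.differentiable one_ne_zero) x)
  · exact (hDFc.mul hη.continuous).integrable_of_hasCompactSupport hηc.mul_left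
  · exact (hFc.mul hDηc).integrable_of_hasCompactSupport hDηs.mul_left
  · exact (hFc.mul hη.continuous).integrable_of_hasCompactSupport hηc.mul_left

/-- **The vertical shear of a `C²` divergence-free field is weakly divergence-free**: `∫ Σᵢ ∂₂Vᵢ ∂ᵢη = −∫ (∂₂ div V) η = 0` for every `C¹`
compactly supported `η`. -/
theorem integral_vertShear_grad_eq_zero (hV : ContDiff ℝ 2 V) (hdiv : VectorCalculus.IsDivFree V) (hη : ContDiff ℝ 1 η)
    (hηc : HasCompactSupport η) :
    ∫ y, (fderiv ℝ V y (EuclideanSpace.single 2 1) 0 * fderiv ℝ η y (EuclideanSpace.single 0 1) +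
      fderiv ℝ V y (EuclideanSpace.single 2 1) 1 * fderiv ℝ η y (EuclideanSpace.single 1 1) +
      fderiv ℝ V y (EuclideanSpace.single 2 1) 2 * fderiv ℝ η y (EuclideanSpace.single 2 1)) = 0 := by
  -- integrability of the three products
  have hint : ∀ i : Fin 3, Integrable fun y => fderiv ℝ V y (EuclideanSpace.single 2 1) i * fderiv ℝ η y (EuclideanSpace.single i 1) := by
    intro i
    have hFc : Continuous fun z => fderiv ℝ V z (EuclideanSpace.single 2 1) i := (contDiff_one_fderiv_apply hV _ i).continuous
    have hDηc : Continuous fun y => fderiv ℝ η y (EuclideanSpace.single i 1) :=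
      (hη.continuous_fderiv one_ne_zero).clm_apply continuous_const
    have hDηs : HasCompactSupport fun y => fderiv ℝ η y (EuclideanSpace.single i 1) :=
      (hηc.fderiv (𝕜 := ℝ)).comp_left (g := fun L : EuclideanSpace ℝ (Fin 3) →L[ℝ] ℝ => L (EuclideanSpace.single i 1)) rfl
    exact (hFc.mul hDηc).integrable_of_hasCompactSupport hDηs.mul_left
  have hint' : ∀ i : Fin 3, Integrable fun y =>
      fderiv ℝ (fun z => fderiv ℝ V z (EuclideanSpace.single 2 1) i) y (EuclideanSpace.single i 1) * η y := by
    intro i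
    have hF : ContDiff ℝ 1 fun z => fderiv ℝ V z (EuclideanSpace.single 2 1) i := contDiff_one_fderiv_apply hV _ i
    have hDFc : Continuous fun y => fderiv ℝ (fun z => fderiv ℝ V z (EuclideanSpace.single 2 1) i) y (EuclideanSpace.single i 1) :=
      (hF.continuous_fderiv one_ne_zero).clm_apply continuous_const
    exact (hDFc.mul hη.continuous).integrable_of_hasCompactSupport hηc.mul_left
  have h01 : Integrable fun y => fderiv ℝ V y (EuclideanSpace.single 2 1) 0 * fderiv ℝ η y (EuclideanSpace.single 0 1) +
      fderiv ℝ V y (EuclideanSpace.single 2 1) 1 * fderiv ℝ η y (EuclideanSpace.single 1 1) := (hint 0).add (hint 1)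
  have h01' : Integrable fun y =>
      fderiv ℝ (fun z => fderiv ℝ V z (EuclideanSpace.single 2 1) 0) y (EuclideanSpace.single 0 1) * η y +
      fderiv ℝ (fun z => fderiv ℝ V z (EuclideanSpace.single 2 1) 1) y (EuclideanSpace.single 1 1) * η y := (hint' 0).add (hint' 1)
  have e1 := integral_add h01 (hint 2)
  have e2 := integral_add (hint 0) (hint 1)
  have e3 := integral_add h01' (hint' 2)
  have e4 := integral_add (hint' 0) (hint' 1)
  rw [e1, e2, integral_vertShear_mul_fderiv_eq_neg hV hη hηc 0, integral_vertShear_mul_fderiv_eq_neg hV hη hηc 1,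
    integral_vertShear_mul_fderiv_eq_neg hV hη hηc 2, ← neg_add, ← neg_add, ← e4, ← e3, neg_eq_zero]
  -- the integrand is `(∂₂ div V) η = 0`
  have hzero : ∀ y, fderiv ℝ (fun z => fderiv ℝ V z (EuclideanSpace.single 2 1) 0) y (EuclideanSpace.single 0 1) * η y +
      fderiv ℝ (fun z => fderiv ℝ V z (EuclideanSpace.single 2 1) 1) y (EuclideanSpace.single 1 1) * η y +
      fderiv ℝ (fun z => fderiv ℝ V z (EuclideanSpace.single 2 1) 2) y (EuclideanSpace.single 2 1) * η y = 0 := by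
    intro y
    rw [fderiv_fderiv_apply_symm hV y (EuclideanSpace.single 2 1) (EuclideanSpace.single 0 1) 0,
      fderiv_fderiv_apply_symm hV y (EuclideanSpace.single 2 1) (EuclideanSpace.single 1 1) 1, ← add_mul, ← add_mul,
      fderiv_divergence_components_eq_zero hV hdiv y (EuclideanSpace.single 2 1), zero_mul]
  simp_rw [hzero, integral_zero]

/-- Expansion of the diagonal bilinear form `Σᵢⱼ (diag d)ᵢⱼ pᵢ rⱼ`. -/
theorem sum_diagonal_mul_mul (d p r : Fin 3 → ℝ) :
    ∑ i, ∑ j, Matrix.diagonal d i j * p i * r j = d 0 * p 0 * r 0 + d 1 * p 1 * r 1 + d 2 * p 2 * r 2 := by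
  simp [Matrix.diagonal_apply, Fin.sum_univ_three]

/-- Expansion of the diagonal quadratic form `ξ ⬝ᵥ (diag d *ᵥ ξ)`. -/
theorem dotProduct_diagonal_mulVec (d ξ : Fin 3 → ℝ) :
    ξ ⬝ᵥ (Matrix.diagonal d *ᵥ ξ) = d 0 * (ξ 0 * ξ 0) + d 1 * (ξ 1 * ξ 1) + d 2 * (ξ 2 * ξ 2) := by
  simp [dotProduct, Matrix.mulVec_diagonal, Fin.sum_univ_three]
  ring

/-- **STUB C1 `stub_ellipticThreadEmpty` (VERBATIM, line `thread_type` of crux `PoloidalWindowRigidity`): no thread in a regular elliptic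
(subsonic) core** — a class e₃-poloidal profile pinned at `(−1,0)` (`N = v₂(−1,0) ≠ 0`, `√(−t)|v₂| ≤ |N|`) cannot have, on a ball around `0` of the
slice `t = −1`, a vertical shear pinched against the horizontal gradient of `v₂` ((REG) `|∂_z vₕ|² ≤ L₁|∇ₕv₂|²`, (ELL) `∂_z vₕ·∇ₕv₂ ≥ L₀|∇ₕv₂|²`,
`L₀ > 0`).  UNCONDITIONAL (the strong maximum principle GT 8.19 is the tree theorem `Literature.Analysis.PDE.divFormStrongMaximumPrinciple_holds`). -/
theorem stub_ellipticThreadEmpty :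
    ∀ (C : ℝ) (v : ℝ → EuclideanSpace ℝ (Fin 3) → EuclideanSpace ℝ (Fin 3)),
      Literature.Analysis.FluidPDE.HasTypeITimeDecay C v →
      ContinuousOn (Function.uncurry v) (Set.Iio (0 : ℝ) ×ˢ Set.univ) →
      (∀ s t : ℝ, s < t → t < 0 → ∀ x, v t x =
        Literature.Analysis.UnboundedOperators.heatExtension (v s) (t - s) x -
          Literature.Analysis.FluidPDE.oseenDuhamel 1 s v v t x) →
      (∀ t < 0, Literature.Analysis.FluidPDE.VectorCalculus.IsDivFree (v t)) →
      (∀ s < 0, ∀ y, ⟪Literature.Analysis.FluidPDE.curl (v s) y, EuclideanSpace.single 2 1⟫_ℝ = 0) →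
      v (-1) 0 2 ≠ 0 → (∀ t < 0, ∀ x, Real.sqrt (-t) * |v t x 2| ≤ |v (-1) 0 2|) →
      (∃ δ : ℝ, 0 < δ ∧ ∃ L₁ : ℝ, ∀ y : EuclideanSpace ℝ (Fin 3), ‖y‖ < δ →
            (fderiv ℝ (v (-1)) y (EuclideanSpace.single 2 1) 0) ^ 2 + (fderiv ℝ (v (-1)) y (EuclideanSpace.single 2 1) 1) ^ 2 ≤
              L₁ * ((fderiv ℝ (v (-1)) y (EuclideanSpace.single 0 1) 2) ^ 2 + (fderiv ℝ (v (-1)) y (EuclideanSpace.single 1 1) 2) ^ 2)) →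
      (∃ δ : ℝ, 0 < δ ∧ ∃ L₀ : ℝ, 0 < L₀ ∧ ∀ y : EuclideanSpace ℝ (Fin 3), ‖y‖ < δ →
            L₀ * ((fderiv ℝ (v (-1)) y (EuclideanSpace.single 0 1) 2) ^ 2 + (fderiv ℝ (v (-1)) y (EuclideanSpace.single 1 1) 2) ^ 2) ≤
              fderiv ℝ (v (-1)) y (EuclideanSpace.single 2 1) 0 * fderiv ℝ (v (-1)) y (EuclideanSpace.single 0 1) 2 +
                fderiv ℝ (v (-1)) y (EuclideanSpace.single 2 1) 1 * fderiv ℝ (v (-1)) y (EuclideanSpace.single 1 1) 2) →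
      False := by
  intro C v hrate hcont hmild hdiv hpol hN hsup hREG hELL
  obtain ⟨δ₁, hδ₁, L₁, hreg⟩ := hREG
  obtain ⟨δ₂, hδ₂, L₀, hL₀, hell⟩ := hELL
  -- regularity of the slice `v(-1)`
  have hA : IsTypeIAncientMild C v := isTypeIAncientMild_of_class hrate hcont hmild hdiv
  have hVs : ContDiff ℝ (⊤ : ℕ∞) (v (-1)) := hA.contDiff_slice (by norm_num)
  have hV3 : ContDiff ℝ 3 (v (-1)) := contDiff_infty.1 hVs 3
  have hV2 : ContDiff ℝ 2 (v (-1)) := hV3.of_le (by norm_num)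
  have hVd : Differentiable ℝ (v (-1)) := hV3.differentiable (by norm_num)
  have hcD : ∀ (a : EuclideanSpace ℝ (Fin 3)) (i : Fin 3), Continuous fun y => fderiv ℝ (v (-1)) y a i := fun a i =>
    (contDiff_one_fderiv_apply hV2 a i).continuous
  -- the frozen law `∂_z v₀ ∂₁v₂ = ∂_z v₁ ∂₀v₂`
  have hfro : ∀ y : EuclideanSpace ℝ (Fin 3), fderiv ℝ (v (-1)) y (EuclideanSpace.single 2 1) 0 * fderiv ℝ (v (-1)) y (EuclideanSpace.single 1 1) 2 =
      fderiv ℝ (v (-1)) y (EuclideanSpace.single 2 1) 1 * fderiv ℝ (v (-1)) y (EuclideanSpace.single 0 1) 2 := by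
    intro y
    have h1 := stub_firstIntegral C v hrate hcont hmild hdiv (EuclideanSpace.single 2 1) hpol (-1) (by norm_num) y
    have h2 := hpol (-1) (by norm_num) y
    simp only [EuclideanSpace.inner_single_right, one_mul] at h1 h2
    exact frozen_shear h1 h2
  -- the ball and the coefficient `Λ`
  set δ : ℝ := min δ₁ δ₂ with hδdef
  have hδ : 0 < δ := lt_min hδ₁ hδ₂
  have hB1 : ∀ y ∈ ball (0 : EuclideanSpace ℝ (Fin 3)) δ, ‖y‖ < δ₁ := fun y hy =>
    lt_of_lt_of_le (mem_ball_zero_iff.1 hy) ((le_of_eq hδdef).trans (min_le_left _ _))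
  have hB2 : ∀ y ∈ ball (0 : EuclideanSpace ℝ (Fin 3)) δ, ‖y‖ < δ₂ := fun y hy =>
    lt_of_lt_of_le (mem_ball_zero_iff.1 hy) ((le_of_eq hδdef).trans (min_le_right _ _))
  obtain ⟨g, hgdef⟩ : ∃ g : EuclideanSpace ℝ (Fin 3) → ℝ, g = fun y =>
      fderiv ℝ (v (-1)) y (EuclideanSpace.single 0 1) 2 ^ 2 + fderiv ℝ (v (-1)) y (EuclideanSpace.single 1 1) 2 ^ 2 := ⟨_, rfl⟩
  obtain ⟨q, hqdef⟩ : ∃ q : EuclideanSpace ℝ (Fin 3) → ℝ, q = fun y =>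
      fderiv ℝ (v (-1)) y (EuclideanSpace.single 2 1) 0 * fderiv ℝ (v (-1)) y (EuclideanSpace.single 0 1) 2 +
        fderiv ℝ (v (-1)) y (EuclideanSpace.single 2 1) 1 * fderiv ℝ (v (-1)) y (EuclideanSpace.single 1 1) 2 := ⟨_, rfl⟩
  obtain ⟨Λ, hΛdef⟩ : ∃ Λ : EuclideanSpace ℝ (Fin 3) → ℝ, Λ = fun y => if g y = 0 then 1 else q y / g y := ⟨_, rfl⟩
  have hgc : Continuous g := by rw [hgdef]; exact ((hcD _ 2).pow 2).add ((hcD _ 2).pow 2)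
  have hqc : Continuous q := by rw [hqdef]; exact ((hcD _ 0).mul (hcD _ 2)).add ((hcD _ 1).mul (hcD _ 2))
  have hΛm : Measurable Λ := by
    rw [hΛdef]
    exact Measurable.ite (measurableSet_eq_fun hgc.measurable measurable_const) measurable_const
      (hqc.measurable.div hgc.measurable)
  have hg0 : ∀ y, 0 ≤ g y := fun y => by rw [hgdef]; positivity
  -- on the ball: `∂_z vₕ = Λ ∇ₕ v₂`, `min L₀ 1 ≤ Λ`, `|Λ| ≤ max L₁ 1`
  have hFΛ : ∀ y ∈ ball (0 : EuclideanSpace ℝ (Fin 3)) δ,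
      fderiv ℝ (v (-1)) y (EuclideanSpace.single 2 1) 0 = Λ y * fderiv ℝ (v (-1)) y (EuclideanSpace.single 0 1) 2 ∧
      fderiv ℝ (v (-1)) y (EuclideanSpace.single 2 1) 1 = Λ y * fderiv ℝ (v (-1)) y (EuclideanSpace.single 1 1) 2 := by
    intro y hy
    by_cases hgy : g y = 0
    · -- `∇ₕ v₂ = 0`, hence `∂_z vₕ = 0` by (REG)
      have hw : fderiv ℝ (v (-1)) y (EuclideanSpace.single 0 1) 2 = 0 ∧ fderiv ℝ (v (-1)) y (EuclideanSpace.single 1 1) 2 = 0 := by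
        rw [hgdef] at hgy
        constructor <;> nlinarith [sq_nonneg (fderiv ℝ (v (-1)) y (EuclideanSpace.single 0 1) 2),
          sq_nonneg (fderiv ℝ (v (-1)) y (EuclideanSpace.single 1 1) 2)]
      have hr := hreg y (hB1 y hy)
      rw [hw.1, hw.2] at hr
      have hF : fderiv ℝ (v (-1)) y (EuclideanSpace.single 2 1) 0 = 0 ∧ fderiv ℝ (v (-1)) y (EuclideanSpace.single 2 1) 1 = 0 := by
        constructor <;> nlinarith [sq_nonneg (fderiv ℝ (v (-1)) y (EuclideanSpace.single 2 1) 0),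
          sq_nonneg (fderiv ℝ (v (-1)) y (EuclideanSpace.single 2 1) 1)]
      rw [hF.1, hF.2, hw.1, hw.2, mul_zero]
      exact ⟨rfl, rfl⟩
    · have hΛy : Λ y = q y / g y := by rw [hΛdef]; exact if_neg hgy
      have hfy := hfro y
      rw [hΛy, hqdef, hgdef]
      rw [hgdef] at hgy
      constructor
      · rw [div_mul_eq_mul_div, eq_div_iff hgy]
        linear_combination (fderiv ℝ (v (-1)) y (EuclideanSpace.single 1 1) 2) * hfy
      · rw [div_mul_eq_mul_div, eq_div_iff hgy]
        linear_combination (-(fderiv ℝ (v (-1)) y (EuclideanSpace.single 0 1) 2)) * hfy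
  have hΛlo : ∀ y ∈ ball (0 : EuclideanSpace ℝ (Fin 3)) δ, min L₀ 1 ≤ Λ y := by
    intro y hy
    by_cases hgy : g y = 0
    · have hΛy : Λ y = 1 := by rw [hΛdef]; exact if_pos hgy
      rw [hΛy]; exact min_le_right _ _
    · have hΛy : Λ y = q y / g y := by rw [hΛdef]; exact if_neg hgy
      have hgpos : 0 < g y := lt_of_le_of_ne (hg0 y) (Ne.symm hgy)
      have he : L₀ * g y ≤ q y := by rw [hgdef, hqdef]; exact hell y (hB2 y hy)
      rw [hΛy, le_div_iff₀ hgpos]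
      nlinarith [min_le_left L₀ 1, hg0 y]
  have hΛhi : ∀ y ∈ ball (0 : EuclideanSpace ℝ (Fin 3)) δ, |Λ y| ≤ max L₁ 1 := by
    intro y hy
    by_cases hgy : g y = 0
    · have hΛy : Λ y = 1 := by rw [hΛdef]; exact if_pos hgy
      rw [hΛy, abs_one]; exact le_max_right _ _
    · have hgpos : 0 < g y := lt_of_le_of_ne (hg0 y) (Ne.symm hgy)
      have hr := hreg y (hB1 y hy)
      obtain ⟨h0, h1⟩ := hFΛ y hy
      rw [h0, h1] at hr
      have hsq : Λ y ^ 2 * g y ≤ L₁ * g y := by rw [hgdef]; nlinarith [hr]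
      have hΛsq : Λ y ^ 2 ≤ L₁ := le_of_mul_le_mul_right hsq hgpos
      by_cases h1 : |Λ y| ≤ 1
      · exact h1.trans (le_max_right _ _)
      · have h1' : 1 < |Λ y| := not_le.1 h1
        have h2 : |Λ y| ≤ Λ y ^ 2 := by rw [← sq_abs]; nlinarith
        exact (h2.trans hΛsq).trans (le_max_left _ _)
  -- the coefficient matrix `a = diag(Λ, Λ, 1)`
  obtain ⟨a, hadef⟩ : ∃ a : EuclideanSpace ℝ (Fin 3) → Matrix (Fin 3) (Fin 3) ℝ, a = fun y => Matrix.diagonal ![Λ y, Λ y, 1] := ⟨_, rfl⟩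
  have ha_meas : ∀ i j, Measurable fun y => a y i j := by
    intro i j
    rw [hadef]
    fin_cases i <;> fin_cases j <;> simp [hΛm]
  have ha_symm : ∀ y ∈ ball (0 : EuclideanSpace ℝ (Fin 3)) δ, (a y).IsSymm := fun y _ => by
    rw [hadef]; exact Matrix.diagonal_transpose _
  have ha_ell : ∀ y ∈ ball (0 : EuclideanSpace ℝ (Fin 3)) δ, ∀ ξ : Fin 3 → ℝ, min L₀ 1 * (ξ ⬝ᵥ ξ) ≤ ξ ⬝ᵥ (a y *ᵥ ξ) := by
    intro y hy ξ
    rw [hadef]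
    simp only [dotProduct_diagonal_mulVec, Matrix.cons_val_zero, Matrix.cons_val_one, Matrix.head_cons, Matrix.cons_val_two,
      Matrix.tail_cons]
    simp only [dotProduct, Fin.sum_univ_three]
    nlinarith [mul_nonneg (sub_nonneg.2 (hΛlo y hy)) (mul_self_nonneg (ξ 0)),
      mul_nonneg (sub_nonneg.2 (hΛlo y hy)) (mul_self_nonneg (ξ 1)),
      mul_nonneg (sub_nonneg.2 (min_le_right L₀ 1)) (mul_self_nonneg (ξ 2))]
  have ha_bdd : ∀ y ∈ ball (0 : EuclideanSpace ℝ (Fin 3)) δ, ∀ i j, |a y i j| ≤ max L₁ 1 := by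
    intro y hy i j
    have h1 := hΛhi y hy
    have h2 : (1 : ℝ) ≤ max L₁ 1 := le_max_right _ _
    have h3 : (0 : ℝ) ≤ max L₁ 1 := zero_le_one.trans h2
    rw [hadef]
    fin_cases i <;> fin_cases j <;> simp [h1, h2, h3]
  -- the sign `σ = sign N` and the solution `u = σ v₂(-1,·)`
  obtain ⟨σ, hσ, hσN⟩ : ∃ σ : ℝ, (σ = 1 ∨ σ = -1) ∧ σ * v (-1) 0 2 = |v (-1) 0 2| := by
    rcases le_or_gt 0 (v (-1) 0 2) with h | h
    · exact ⟨1, Or.inl rfl, by rw [one_mul, abs_of_nonneg h]⟩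
    · exact ⟨-1, Or.inr rfl, by rw [abs_of_neg h]; ring⟩
  obtain ⟨u, hudef⟩ : ∃ u : EuclideanSpace ℝ (Fin 3) → ℝ, u = fun y => σ * v (-1) y 2 := ⟨_, rfl⟩
  have hu3 : ContDiff ℝ 3 u := by rw [hudef]; exact contDiff_const.mul (contDiff_coord hV3 2)
  have hDu : ∀ y (b : EuclideanSpace ℝ (Fin 3)), fderiv ℝ u y b = σ * fderiv ℝ (v (-1)) y b 2 := by
    intro y b
    rw [hudef, fderiv_const_mul ((contDiff_coord hV3 2).differentiable (by norm_num) y)]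
    simp only [FunLike.coe_smul, Pi.smul_apply, smul_eq_mul]
    rw [fderiv_coord_apply (hVd y) 2]
  -- the weak formulation: `Σᵢⱼ aᵢⱼ ∂ᵢu ∂ⱼη = σ Σᵢ ∂_z vᵢ ∂ᵢη` pointwise, and the latter integrates to `0`
  have hweak : ∀ η : EuclideanSpace ℝ (Fin 3) → ℝ, ContDiff ℝ 1 η → HasCompactSupport η → tsupport η ⊆ ball (0 : EuclideanSpace ℝ (Fin 3)) δ →
      ∫ y, ∑ i, ∑ j, a y i j * fderiv ℝ u y (EuclideanSpace.single i 1) * fderiv ℝ η y (EuclideanSpace.single j 1) = 0 := by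
    intro η hη hηc hηΩ
    have hpt : ∀ y, ∑ i, ∑ j, a y i j * fderiv ℝ u y (EuclideanSpace.single i 1) * fderiv ℝ η y (EuclideanSpace.single j 1) =
        σ * (fderiv ℝ (v (-1)) y (EuclideanSpace.single 2 1) 0 * fderiv ℝ η y (EuclideanSpace.single 0 1) +
          fderiv ℝ (v (-1)) y (EuclideanSpace.single 2 1) 1 * fderiv ℝ η y (EuclideanSpace.single 1 1) +
          fderiv ℝ (v (-1)) y (EuclideanSpace.single 2 1) 2 * fderiv ℝ η y (EuclideanSpace.single 2 1)) := by
      intro y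
      rw [hadef]
      simp only [sum_diagonal_mul_mul, Matrix.cons_val_zero, Matrix.cons_val_one, Matrix.head_cons, Matrix.cons_val_two,
        Matrix.tail_cons, hDu]
      by_cases hy : y ∈ ball (0 : EuclideanSpace ℝ (Fin 3)) δ
      · obtain ⟨h0, h1⟩ := hFΛ y hy
        rw [h0, h1]; ring
      · have hyη : y ∉ tsupport η := fun h => hy (hηΩ h)
        rw [fderiv_of_notMem_tsupport ℝ hyη]
        simp
    simp_rw [hpt]
    rw [integral_const_mul, integral_vertShear_grad_eq_zero hV2 (hdiv (-1) (by norm_num)) hη hηc, mul_zero]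
  -- the interior maximum at the centre
  have hmax : ∀ y ∈ ball (0 : EuclideanSpace ℝ (Fin 3)) δ, u y ≤ u 0 := by
    intro y _
    rw [hudef]
    simp only
    rw [hσN]
    have h1 := hsup (-1) (by norm_num) y
    rw [neg_neg, Real.sqrt_one, one_mul] at h1
    have h2 : σ * v (-1) y 2 ≤ |v (-1) y 2| := by
      rcases hσ with rfl | rfl
      · rw [one_mul]; exact le_abs_self _
      · rw [neg_one_mul]; exact neg_le_abs _
    exact h2.trans h1
  -- the strong maximum principle (GT 8.19, tree theorem)
  have hSMP := Literature.Analysis.PDE.divFormStrongMaximumPrinciple_holds 3 (ball (0 : EuclideanSpace ℝ (Fin 3)) δ) isOpen_ball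
    (convex_ball (0 : EuclideanSpace ℝ (Fin 3)) δ).isPreconnected a (min L₀ 1) (max L₁ 1) (lt_min hL₀ one_pos) ha_meas ha_symm ha_ell ha_bdd u
    ((hu3.of_le (by norm_num)).contDiffOn) hweak 0 (mem_ball_self hδ) hmax
  -- `v₂(-1,·)` is constant on the ball, so `∂₀ v₂ = 0` there
  have hconst : ∀ y ∈ ball (0 : EuclideanSpace ℝ (Fin 3)) δ, v (-1) y 2 = v (-1) 0 2 := by
    intro y hy
    have h := hSMP y hy
    rw [hudef] at h
    simp only at h
    rcases hσ with rfl | rfl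
    · linarith
    · linarith
  have hD0 : ∀ y ∈ ball (0 : EuclideanSpace ℝ (Fin 3)) δ, fderiv ℝ (v (-1)) y (EuclideanSpace.single 0 1) 2 = 0 := by
    intro y hy
    rw [← fderiv_coord_apply (hVd y) 2]
    have hev : (fun z => v (-1) z 2) =ᶠ[𝓝 y] fun _ => v (-1) 0 2 :=
      Filter.eventually_of_mem (isOpen_ball.mem_nhds hy) fun z hz => hconst z hz
    rw [hev.fderiv_eq, fderiv_const_apply]
    rfl
  have hz := eq_zero_of_horizontalGradient_eq_zero_on_open hrate hcont hmild hdiv (s := -1) (by norm_num)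
    (hpol (-1) (by norm_num)) isOpen_ball ⟨0, mem_ball_self hδ⟩ hD0
  exact hN (by rw [hz (-1) (by norm_num) 0]; rfl)

end Summit.NavierStokesRegularity.NavierStokesRegularity.Theorems.PoloidalWindowDoorPoloidalWindowRigidityEllipticThreadEmpty

end
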